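import Summits.HodgeConjecture.HodgeConjecture.Theses.NoetherLefschetzOneUp
import Literature.AlgebraicGeometry.Motives.SegreEmbedding
import Literature.AlgebraicGeometry.HodgeTheory.ComplexConjugationHolds
import Literature.AlgebraicGeometry.Surfaces.K3Surface
import Literature.AlgebraicGeometry.Surfaces.K3ComplexMultiplication

/-!
# Piece `PgOneProductClasses` of crux `K3TypeNets` (stmt-HodgeConjecture-11600) — birth skeleton (BC3)

Route `HodgeConjecture/NoetherLefschetzOneUp`; BC2-redirect `K3TypeNets ⇐ PgOneProductClasses ∧
K3TypeNetsGrantedProducts` (crux-strategist r1, 2026-08-17). THIS FILE plans the PRODUCT SECTOR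

  `PgOneProductClasses` (P): for smooth projective complex surfaces `S₁`, `S₂` with `h^{2,0}(S₁) = 1`,
  every rational `(2,2)`-class on `S₁ × S₂` (`S₁ ⊗ S₂` in `SchemeOver ℂ = Over (Spec ℂ)`, smooth projective
  of dimension `4` by `IsSmoothProjective.tensor_holds`) lies in `algebraicClasses (S₁ ⊗ S₂) 2`.

WHY IT IS A PIECE OF `K3TypeNets` (lead census CENSUS-c2.md §1, strategist s2 STRATEGY-CENSUS.md §Transfer (e),
refuter SCOPE.md on the item): K3-type nets over `ℙ²` contain fourfolds dominated by such products —
`Bl(S × S') → ℙ²` with fibres `E_s × E'_t` (RM classes in `T(S) ⊗ T(S')`), relative Kummer nets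
`Km(E_s × E'_t)`, bi-double covers `(S × B)/(ι × τ) → B/τ = ℙ²` with `B` ANY double plane (classes
`Hom_Hdg(T(S), T(B))`) — so on that sector `K3TypeNets` IS (modulo the blow-up formula and `g_* g^* = deg`)
the algebraicity of Hodge classes on `S₁ × S₂`, `p_g(S₁) = 1`, `S₂` arbitrary. By Künneth and Lefschetz
`(1,1)` this is the algebraicity of HODGE MORPHISMS `H²(S₂, ℚ) → H²(S₁, ℚ)`, i.e. of `Hom_Hdg(T(S₂), T(S₁))`
with `T(S₁)` an irreducible Hodge structure of K3 type: Hodge isometries between K3 surfaces are algebraic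
(Mukai, Nikulin, Buskin 2019 Thm 1.1 — tree fact `Surfaces.Buskin2019_hodgeIsometry_algebraic`; CM squares,
Huybrechts 2019 Cor. 0.4 — tree fact `Surfaces.Buskin2019_hodgeConjectureFor_square_of_CM`); Hodge
SIMILARITIES of non-square multiplier and REAL MULTIPLICATION classes are open (Varesco 2023, Introduction;
van Geemen 2008 §3; in-house open items stmt-13676 `HodgeSimilitudeAlgebraic`, stmt-13680
`SquareHodgeOfSqrtTwo`, routes NikulinTwinSimilitude / NikulinTwinTransport / TwinTwistorTransport /
KugaSatake*); products of abelian surfaces contain Weil-type abelian fourfolds (Moonen–Zarhin 1999; Schoen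
1988, Markman 2025 for special discriminants).

THE CUT (three registered stubs, by the second factor's geometric genus and the K3 × K3 core):

* `stub_pgZeroFactor` (L; THEOREM IN PRINT, folklore): `p_g(S₂) = 0` ⇒ `H²(S₂, ℚ) = NS(S₂)_ℚ` (Lefschetz
  `(1,1)`), so by Künneth a rational `(2,2)`-class on `S₁ × S₂` is `[S₁ × pt] ⊕ (divisors ⊠ divisors) ⊕
  (1 ⊗ L)(divisor classes of S₁ × S₂ in H¹ ⊗ H¹) ⊕ [pt × S₂]` — algebraic; NO hypothesis on `S₁`.
* `stub_k3Pairs` (XL/open core): both factors K3 (`Surfaces.IsK3Surface`): every rational `(2,2)`-class on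
  `S₁ × S₂` is algebraic ⟺ every Hodge morphism `T(S₂)_ℚ → T(S₁)_ℚ` is algebraic — isometries and CM:
  known; similarities / RM: open (the NikulinTwin* routes' programme).
* `stub_residualPgOnePairs` (XL/open): `p_g(S₁) = 1`, `p_g(S₂) ≥ 1`, not both K3: abelian × abelian
  (Weil-type fourfolds `B × B`), K3 × abelian (Kummer / Shioda–Inose correspondence reduces to K3 × Km),
  K3 × (`p_g ≥ 2`) surfaces (`Hom_Hdg(T(S₂), T(S₁))`, the bi-double-cover classes), non-K3 regular `p_g = 1`
  surfaces (Kynev–Todorov).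

Composition `PgOneProductClasses_of` (§3, no `sorry`): `by_cases p_g(S₂) = 0` (a Hodge model of `S₂` exists
unconditionally: `nonempty_hodgeModel_holds`, Serre GAGA + Hodge decomposition), then `by_cases` both K3.
Until the route split lands, `PgOneProductClasses` is a LOCAL def with the exact `children.json` statement.

## References

* [Buskin2019] N. Buskin, *Every rational Hodge isometry between two K3 surfaces is algebraic*, J. reine
  angew. Math. 755 (2019) 127–150, Thm. 1.1 and Corollary. [Huybrechts2019] D. Huybrechts, *Motives of
  isogenous K3 surfaces*, Comment. Math. Helv. 94 (2019), Thm. 0.2, Cor. 0.4, Rem. 3.3.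
* [Varesco2023] M. Varesco, *Hodge similarities, algebraic classes, and Kuga–Satake varieties*,
  arXiv:2304.02519, Introduction and Thm. 2.1. [VanGeemen2008RM] B. van Geemen, *Real multiplication on K3
  surfaces and Kuga–Satake varieties*, Michigan Math. J. 56 (2008), §3.
* [MoonenZarhin1999] B. Moonen, Yu. Zarhin, *Hodge classes on abelian varieties of low dimension*, Math.
  Ann. 315 (1999). [Markman2025SecantWeil] E. Markman, arXiv:2502.03415 (Weil classes, special discriminants).
* [VoisinHodgeI2002] C. Voisin, *Hodge Theory and Complex Algebraic Geometry I*, Thm. 11.30 (Lefschetz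
  `(1,1)`), Thm. 11.38 (Künneth), Thm. 6.25 (hard Lefschetz). [Deligne2000] P. Deligne, Clay problem, §1.
-/

noncomputable section

set_option linter.dupNamespace false

open CategoryTheory AlgebraicGeometry MonoidalCategory

namespace Summit.HodgeConjecture.HodgeConjecture.Cruxes.PgOneProductClasses.Birth

open Literature.AlgebraicGeometry.Motives Literature.AlgebraicGeometry.HodgeTheory
open Literature.AlgebraicGeometry.Surfaces (IsK3Surface)

/-! ## §0 The piece (local copy of the route decl-to-be; verbatim the `children.json` statement) -/

/-- PIECE P — THE PRODUCT SECTOR: `HC(2,2)` for `S₁ × S₂`, `S₁` a smooth projective complex surface with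
`h^{2,0} = 1`, `S₂` any smooth projective complex surface. [cite: Buskin2019, Thm. 1.1]
[cite: Varesco2023, Introduction] [cite: VanGeemen2008RM, §3] [cite: Deligne2000, §1] -/
def PgOneProductClasses : Prop :=
  ∀ ⦃S₁ S₂ : SchemeOver ℂ⦄, IsSmoothProjective 2 S₁ → IsSmoothProjective 2 S₂ →
    (∃ A : HodgeModel 2 S₁, Module.finrank ℂ ↥(A.hodgePQ 2 2 0) = 1) →
    ∀ c : complexBetti (S₁ ⊗ S₂) (2 * 2), IsRationalClass c → IsOfHodgeType 4 (S₁ ⊗ S₂) (2 * 2) 2 2 c →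
      c ∈ algebraicClasses (S₁ ⊗ S₂) 2

/-! ## §1 The three registered stubs (`sorry` lives ONLY here) -/

/-- **Stub P1 — a factor of geometric genus zero** (size L; THEOREM IN PRINT, folklore): if `p_g(S₂) = 0`
then every rational `(2,2)`-class on `S₁ × S₂` is algebraic, for ANY smooth projective surface `S₁`.
Proof in print: `H²(S₂, ℚ) = NS(S₂)_ℚ` (no `(2,0)`-part, Lefschetz `(1,1)`); Künneth
`H⁴(S₁ × S₂) = H⁰⊗H⁴ ⊕ H¹⊗H³ ⊕ H²⊗H² ⊕ H³⊗H¹ ⊕ H⁴⊗H⁰` over `ℚ`, compatibly with Hodge types; the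
`H² ⊗ NS`-component of a `(2,2)`-class is `Σ αᵢ ⊠ Dᵢ` with `αᵢ` rational `(1,1)`, hence divisors ⊠ divisors;
`H¹ ⊗ H³ = (1 ⊗ L)(H¹ ⊗ H¹)` by hard Lefschetz on `S₂` and the rational `(1,1)`-classes of `H¹ ⊗ H¹ ⊂
H²(S₁ × S₂)` are divisor classes, whose cup with `pr₂^* L` is algebraic; `H⁰ ⊗ H⁴`, `H⁴ ⊗ H⁰` are `[S₁ × pt]`,
`[pt × S₂]`. [cite: VoisinHodgeI2002, Thm. 11.30, Thm. 11.38 and Thm. 6.25] -/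
theorem stub_pgZeroFactor :
    ∀ ⦃S₁ S₂ : SchemeOver ℂ⦄, IsSmoothProjective 2 S₁ → IsSmoothProjective 2 S₂ →
      (∃ A : HodgeModel 2 S₂, Module.finrank ℂ ↥(A.hodgePQ 2 2 0) = 0) →
      ∀ c : complexBetti (S₁ ⊗ S₂) (2 * 2), IsRationalClass c → IsOfHodgeType 4 (S₁ ⊗ S₂) (2 * 2) 2 2 c →
        c ∈ algebraicClasses (S₁ ⊗ S₂) 2 := by
  sorry

/-- **Stub P2 — K3 pairs** (size XL; the OPEN CORE): for K3 surfaces `S₁`, `S₂` every rational `(2,2)`-class on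
`S₁ × S₂` is algebraic. Equivalently (Künneth + Lefschetz `(1,1)` + `[pt × S]`, `[S × pt]`): every Hodge
morphism `T(S₂)_ℚ → T(S₁)_ℚ` of the transcendental lattices is induced by an algebraic class. Known:
Hodge ISOMETRIES (Mukai, Nikulin, Buskin 2019 Thm. 1.1 — tree fact `Buskin2019_hodgeIsometry_algebraic`),
hence `S₁ = S₂` with `End_Hdg(T) ∈ {ℚ, CM field}` (Huybrechts 2019 Cor. 0.4; tree fact
`Buskin2019_hodgeConjectureFor_square_of_CM`); open: similarities of non-square multiplier (in-house
stmt-13676) and real multiplication (`√2` beyond the Nikulin locus: stmt-13680; general totally real `E`).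
[cite: Buskin2019, Thm. 1.1] [cite: Huybrechts2019, Cor. 0.4 and Rem. 3.3] [cite: Varesco2023, Introduction and Thm. 2.1] -/
theorem stub_k3Pairs :
    ∀ ⦃S₁ S₂ : SchemeOver ℂ⦄, IsK3Surface S₁ → IsK3Surface S₂ →
      ∀ c : complexBetti (S₁ ⊗ S₂) (2 * 2), IsRationalClass c → IsOfHodgeType 4 (S₁ ⊗ S₂) (2 * 2) 2 2 c →
        c ∈ algebraicClasses (S₁ ⊗ S₂) 2 := by
  sorry

/-- **Stub P3 — the residual genus-one pairs** (size XL; open): `p_g(S₁) = 1`, `p_g(S₂) ≥ 1`, NOT both K3: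
products of abelian surfaces (they contain the Weil-type abelian fourfolds `B × B`, Moonen–Zarhin 1999;
algebraic for special discriminants only — Schoen 1988, Markman 2025), K3 × abelian surface (the Kummer /
Shioda–Inose correspondence `T(A) ≅ T(Km A)` is algebraic and reduces to P2-type morphisms), K3 × surfaces
with `p_g ≥ 2` (`Hom_Hdg(T(S₂), T(S₁))` — the bi-double-cover classes of the crux), and the non-K3 regular
`p_g = 1` surfaces (Kynev–Todorov). HC-implied. [cite: MoonenZarhin1999, §0]
[cite: Markman2025SecantWeil, Thm. 1.1] [cite: Varesco2023, Introduction] -/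
theorem stub_residualPgOnePairs :
    ∀ ⦃S₁ S₂ : SchemeOver ℂ⦄, IsSmoothProjective 2 S₁ → IsSmoothProjective 2 S₂ →
      (∃ A : HodgeModel 2 S₁, Module.finrank ℂ ↥(A.hodgePQ 2 2 0) = 1) →
      (∃ A : HodgeModel 2 S₂, Module.finrank ℂ ↥(A.hodgePQ 2 2 0) ≠ 0) →
      ¬ (IsK3Surface S₁ ∧ IsK3Surface S₂) →
      ∀ c : complexBetti (S₁ ⊗ S₂) (2 * 2), IsRationalClass c → IsOfHodgeType 4 (S₁ ⊗ S₂) (2 * 2) 2 2 c →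
        c ∈ algebraicClasses (S₁ ⊗ S₂) 2 := by
  sorry

/-! ## §2 Name-keyed statements of the stubs (verbatim) -/

namespace Registered

/-- Statement of `stub_pgZeroFactor`, verbatim. -/
abbrev stub_pgZeroFactor : Prop :=
  ∀ ⦃S₁ S₂ : SchemeOver ℂ⦄, IsSmoothProjective 2 S₁ → IsSmoothProjective 2 S₂ →
    (∃ A : HodgeModel 2 S₂, Module.finrank ℂ ↥(A.hodgePQ 2 2 0) = 0) →
    ∀ c : complexBetti (S₁ ⊗ S₂) (2 * 2), IsRationalClass c → IsOfHodgeType 4 (S₁ ⊗ S₂) (2 * 2) 2 2 c →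
      c ∈ algebraicClasses (S₁ ⊗ S₂) 2

/-- Statement of `stub_k3Pairs`, verbatim. -/
abbrev stub_k3Pairs : Prop :=
  ∀ ⦃S₁ S₂ : SchemeOver ℂ⦄, IsK3Surface S₁ → IsK3Surface S₂ →
    ∀ c : complexBetti (S₁ ⊗ S₂) (2 * 2), IsRationalClass c → IsOfHodgeType 4 (S₁ ⊗ S₂) (2 * 2) 2 2 c →
      c ∈ algebraicClasses (S₁ ⊗ S₂) 2

/-- Statement of `stub_residualPgOnePairs`, verbatim. -/
abbrev stub_residualPgOnePairs : Prop :=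
  ∀ ⦃S₁ S₂ : SchemeOver ℂ⦄, IsSmoothProjective 2 S₁ → IsSmoothProjective 2 S₂ →
    (∃ A : HodgeModel 2 S₁, Module.finrank ℂ ↥(A.hodgePQ 2 2 0) = 1) →
    (∃ A : HodgeModel 2 S₂, Module.finrank ℂ ↥(A.hodgePQ 2 2 0) ≠ 0) →
    ¬ (IsK3Surface S₁ ∧ IsK3Surface S₂) →
    ∀ c : complexBetti (S₁ ⊗ S₂) (2 * 2), IsRationalClass c → IsOfHodgeType 4 (S₁ ⊗ S₂) (2 * 2) 2 2 c →
      c ∈ algebraicClasses (S₁ ⊗ S₂) 2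

end Registered

/-! ## §3 Composition (no `sorry` from here on) -/

/-- **The piece `PgOneProductClasses` from the three stubs** (kernel-checked, no `sorry`): split on the
geometric genus of the second factor — a Hodge model of `S₂` EXISTS unconditionally
(`nonempty_hodgeModel_holds`: Serre GAGA + de Rham + Hodge decomposition), so `¬ (∃ A, h^{2,0}(A) = 0)` gives
a model with `h^{2,0} ≠ 0` — and then on whether both factors are K3.
[cite: VoisinHodgeI2002, §6.1.3 Prop. 6.11] [cite: Buskin2019, Thm. 1.1] -/
theorem PgOneProductClasses_of (h₁ : Registered.stub_pgZeroFactor) (h₂ : Registered.stub_k3Pairs)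
    (h₃ : Registered.stub_residualPgOnePairs) : PgOneProductClasses := by
  intro S₁ S₂ hS₁ hS₂ hpg c hc hpp
  by_cases hz : ∃ A : HodgeModel 2 S₂, Module.finrank ℂ ↥(A.hodgePQ 2 2 0) = 0
  · -- a factor of geometric genus zero: theorem in print
    exact h₁ hS₁ hS₂ hz c hc hpp
  · -- `p_g(S₂) ≥ 1` on SOME (hence every) Hodge model, which exists unconditionally
    have hpos : ∃ A : HodgeModel 2 S₂, Module.finrank ℂ ↥(A.hodgePQ 2 2 0) ≠ 0 := by
      obtain ⟨A⟩ := nonempty_hodgeModel_holds (n := 2) (X := S₂) hS₂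
      push Not at hz
      exact ⟨A, hz A⟩
    by_cases hK3 : IsK3Surface S₁ ∧ IsK3Surface S₂
    · -- the K3 × K3 core
      exact h₂ hK3.1 hK3.2 c hc hpp
    · -- the residual genus-one pairs
      exact h₃ hS₁ hS₂ hpg hpos hK3 c hc hpp

/-! ## §4 Wiring check, converse, and the in-tree special case -/

/-- The registered stubs feed the composition VERBATIM (inherits the three `sorry`s; not a proof). -/
theorem pgOneProductClasses_holds_of_stubs : PgOneProductClasses :=
  PgOneProductClasses_of stub_pgZeroFactor stub_k3Pairs stub_residualPgOnePairs

/-- Converse: the piece is a consequence of the Hodge conjecture (products of smooth projective surfaces are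
smooth projective fourfolds, `IsSmoothProjective.tensor_holds` — Segre). [cite: Deligne2000, §1] -/
theorem pgOneProductClasses_of_hodgeConjecture (h : _root_.HodgeConjecture) : PgOneProductClasses := by
  intro S₁ S₂ hS₁ hS₂ _ c hc hpp
  exact (h (IsSmoothProjective.tensor_holds hS₁ hS₂)).2 2 c hc hpp

/-- BC5-type special case ALREADY NAMED in the tree (conditional on the cited fact, which is in print):
the CM K3 squares inside stub P2 — `Buskin2019_hodgeConjectureFor_square_of_CM` gives every rational
`(2,2)`-class on `S ⊗ S` for a CM K3 surface `S`. [cite: Huybrechts2019, Cor. 0.4 (ii)] -/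
theorem k3Pairs_square_of_CM
    (hB : Literature.AlgebraicGeometry.Surfaces.Buskin2019_hodgeConjectureFor_square_of_CM)
    {S : SchemeOver ℂ} (hS : IsK3Surface S)
    (hCM : Literature.AlgebraicGeometry.Surfaces.HasComplexMultiplication S)
    (c : complexBetti (S ⊗ S) (2 * 2)) (hc : IsRationalClass c) (hpp : IsOfHodgeType 4 (S ⊗ S) (2 * 2) 2 2 c) :
    c ∈ algebraicClasses (S ⊗ S) 2 :=
  Literature.AlgebraicGeometry.Surfaces.mem_algebraicClasses_tensor_self_of_CM hB hS hCM 2 c hc hpp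

end Summit.HodgeConjecture.HodgeConjecture.Cruxes.PgOneProductClasses.Birth

end
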